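import Literature.AnabelianGeometry.SemiGraphs.CoveringComponent
import Literature.AnabelianGeometry.SemiGraphs.SubdivisionLemmas

/-!
# Components of a covering of a connected semi-graph meet every fibre ([SemiAnbd] §3 p. 37)

  For a covering `T` of a semi-graph of anabelioids `𝒢` whose underlying semi-graph
is connected, the connected component (`CovObj.SameComponent`, Def. 3.5 (ii)) of a vertex point
of `T` contains a point over EVERY vertex and every edge of `𝒢`: starting from a point over `v₀`,
follow a walk of the barycentric subdivision of `𝔾`, transporting points through the gluings
`S_e ≅ S_v` and their inverses.  (Used for the fibre functor "points over `v₀`" on `B^temp(𝒢)`: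
it sees every component.)
-/

namespace Literature.AnabelianGeometry.SemiGraphs

namespace ProfiniteSemiGraph

open CategoryTheory

universe u

variable {𝒢 : ProfiniteSemiGraph.{u}} (T : CovObj 𝒢) (p : T.Point)

/-- "The component of `p` has a point over the node `n` of the subdivision of `𝔾`" (over a
vertex: a vertex point; over an edge or a branch of it: an edge point).
[cite: MochizukiSemiAnbd2006, Def 3.5(ii) p.37] -/
def CovObj.HasPtOver : 𝒢.graph.Node → Prop
  | Sum.inl v => ∃ x : (T.SV v).obj.V, T.SameComponent p (Sum.inl ⟨v, x⟩)
  | Sum.inr (Sum.inl e) => ∃ y : (T.SE e).obj.V, T.SameComponent p (Sum.inr ⟨e, y⟩)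
  | Sum.inr (Sum.inr b) => ∃ y : (T.SE (𝒢.graph.edgeOf b)).obj.V, T.SameComponent p (Sum.inr ⟨_, y⟩)

/-- Transport of `HasPtOver` along an adjacency of the subdivision (gluing and inverse gluing).
[cite: MochizukiSemiAnbd2006, Def 3.5(ii) p.37] -/
theorem CovObj.hasPtOver_step (n n' : 𝒢.graph.Node) (h : 𝒢.graph.NodeRel n n' ∨ 𝒢.graph.NodeRel n' n)
    (hn : T.HasPtOver p n) : T.HasPtOver p n' := by
  rcases h with h | h
  · cases h with
    | edge_branch b =>
      obtain ⟨y, hy⟩ := hn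
      exact ⟨y, hy⟩
    | branch_vertex b v hb =>
      obtain ⟨y, hy⟩ := hn
      exact ⟨_, T.sameComponent_glue p b v hb y hy⟩
  · cases h with
    | edge_branch b =>
      obtain ⟨y, hy⟩ := hn
      exact ⟨y, hy⟩
    | branch_vertex b v hb =>
      obtain ⟨x, hx⟩ := hn
      exact ⟨_, T.sameComponent_glue_inv p b v hb x hx⟩

/-- Transport of `HasPtOver` along walks of the subdivision. [cite: MochizukiSemiAnbd2006, Def 3.5(ii) p.37] -/
theorem CovObj.hasPtOver_of_walk {n n' : 𝒢.graph.Node} (w : 𝒢.graph.subdivision.Walk n n')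
    (hn : T.HasPtOver p n) : T.HasPtOver p n' := by
  induction w with
  | nil => exact hn
  | cons hadj w' ih =>
    exact ih (T.hasPtOver_step p _ _ ((SemiGraph.subdivision_adj_iff _).mp hadj) hn)

/-- **In a covering of a connected semi-graph of anabelioids, the component of a vertex point has a
point over every vertex.** [cite: MochizukiSemiAnbd2006, Def 3.5(ii) p.37] -/
theorem CovObj.exists_mem_component_over (hc : 𝒢.graph.IsConnected) {v₀ : 𝒢.graph.Vertex}
    (x₀ : (T.SV v₀).obj.V) (v : 𝒢.graph.Vertex) :
    ∃ x : (T.SV v).obj.V, T.SameComponent (Sum.inl ⟨v₀, x₀⟩) (Sum.inl ⟨v, x⟩) := by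
  obtain ⟨w⟩ := (hc.connected (Sum.inl v₀) (Sum.inl v) : 𝒢.graph.subdivision.Reachable _ _)
  exact T.hasPtOver_of_walk (Sum.inl ⟨v₀, x₀⟩) w ⟨x₀, Relation.EqvGen.refl _⟩

/-- Edge version: the component of a vertex point has a point over every edge which has an
abutting branch (every edge, if `𝒢` has a vertex and is connected).
[cite: MochizukiSemiAnbd2006, Def 3.5(ii) p.37] -/
theorem CovObj.exists_mem_component_over_edge (hc : 𝒢.graph.IsConnected) {v₀ : 𝒢.graph.Vertex}
    (x₀ : (T.SV v₀).obj.V) (b : 𝒢.graph.Branch) (v : 𝒢.graph.Vertex) (hb : 𝒢.graph.abuts b = some v) :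
    ∃ y : (T.SE (𝒢.graph.edgeOf b)).obj.V, T.SameComponent (Sum.inl ⟨v₀, x₀⟩) (Sum.inr ⟨_, y⟩) := by
  obtain ⟨x, hx⟩ := T.exists_mem_component_over hc x₀ v
  exact ⟨_, T.sameComponent_glue_inv _ b v hb x hx⟩

end ProfiniteSemiGraph

end Literature.AnabelianGeometry.SemiGraphs
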